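import Literature.RepresentationTheory.KonnoKonno2007.JunctionLinearRealGroup
import Literature.NumberTheory.Automorphic.ArchGroupGLCartan
import Literature.Algebra.Lie.SelfAdjointHullPolar
import Literature.NumberTheory.Automorphic.RealMatrixGroupsProofs
import HarnessLib

/-!
# The global Cartan decomposition of `U(J)` and of `U(α, β)`: `U(J) = (U(J) ∩ U(n)) · exp 𝔭`

Topic `RepresentationTheory/KonnoKonno2007`; namespace `Literature.RepresentationTheory.KonnoKonno2007` (the namespace of
`unitaryFormGroup` ∕ `uFormGroup`, ★ `JunctionLinearRealGroup`).  PROOF lane: theorems only, no definition, no named fact,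
no `sorry`.  Cell hodgecm-mathlib (D-0151), FLOOR 0; author A-p09 (g19).  Consumer: the ENGINE-INTERFACES §7f reuse map of
F0P3-plan (g0) — the hypothesis **`hG : (uFormGroup α β).HasCartanDecomposition`** of the Harish-Chandra facts G1
(`Literature.NumberTheory.Automorphic.GKModules` :441 ∕ :456, `isAdmissibleGK_of_irreducible_unitary`,
`isIrreducibleGK_of_isTopIrreducible_unitary`) at `G := uFormGroup (Fin 2) (Fin 1)` (F1a batch), and of
`RealMatrixGroup.isMaximalCompact_maximalCompact`.

THE THEOREM (`unitaryFormGroup_hasCartanDecomposition`, `uFormGroup_hasCartanDecomposition`).  For a hermitian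
involution `J` (`Jᴴ = J`, `J² = 1`) every `g ∈ U(J) = {g | gᴴ J g = J}` is `k · exp L` with `k ∈ U(J) ∩ U(n)`
(`RealMatrixGroup.maximalCompact`) and `L` hermitian in `𝔲(J) = {X | Xᴴ J + J X = 0}`
(`RealMatrixGroup.HasCartanDecomposition`, [Knapp2002, Prop. 1.2, Thm. 6.31 (c); Prop. 7.14 (self-adjoint groups)]);
in particular for `U(α, β) = uFormGroup α β` (`J = diag(1_α, −1_β)`) at every signature.

PROOF (polar decomposition + its uniqueness; no `KAK`).  By the polar decomposition of `GL_n(ℂ)`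
(★ `exists_unitary_mul_exp_of_isUnit`: `g = k · e^L`, `kᴴ k = 1`, `L` hermitian) and `gᴴ J g = J`:
`W := kᴴ J k` is a hermitian involution with `e^L W e^L = J`, whence `(J e^{−L} J)² = e^{2L}`, i.e.
`e^{2(−JLJ)} = e^{2L}` with both exponents hermitian; `exp` is injective on hermitian matrices
(★ `Literature.Algebra.Lie.SelfAdjointHullPolar.exp_injective_of_isHermitian`, [GoodmanWallachGTM255, Lemma 11.5.7]),
so `JLJ = −L`, i.e. `L ∈ 𝔲(J)`, and then `W = e^{−L} J e^{−L} = J`, i.e. `k ∈ U(J)`.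

HONEST LABEL: HC_CM is proved only modulo the 7 printed citations until rung 0 closes; this file discharges none of them (it
removes one standing hypothesis of the floor-0 letters F1a).

EDITION 2 (append, A-p09 (g19)): the corollary that `U(J) ∩ U(n)` (resp. `U(α) × U(β)`) is a MAXIMAL compact subgroup of `U(J)`
(resp. `U(α, β)`), by ★ `RealMatrixGroup.eq_maximalCompact_of_le_of_isCompact` [Knapp2002, Thm. 6.31 (g)] now that its hypothesis
`HasCartanDecomposition` is a theorem here (`unitaryFormGroup_eq_maximalCompact_of_le_of_isCompact`,
`uFormGroup_eq_maximalCompact_of_le_of_isCompact`); one import added, every earlier declaration byte-identical.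

## References
* [Knapp2002] A. W. Knapp, *Lie Groups Beyond an Introduction*, 2nd ed., Birkhäuser 2002 — I §1 Prop. 1.2 (polar decomposition),
  VI §2 Thm. 6.31 (c) (global Cartan decomposition), VII §2 Prop. 7.14 (groups stable under conjugate transpose).
* [BorelJacquet1979] A. Borel, H. Jacquet, Corvallis 1979, §1.1 (as in ★ `ArchGroupGLCartan`).
* [GoodmanWallachGTM255] R. Goodman, N. R. Wallach, GTM 255 (2009), Lemma 11.5.7, Thm. 11.5.9 (as in ★ `SelfAdjointHullPolar`).
-/

set_option autoImplicit false

open scoped Matrix MatrixGroups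
open NormedSpace -- for `exp`
open Literature.NumberTheory.Automorphic

noncomputable section

namespace Literature.RepresentationTheory.KonnoKonno2007

variable {n : Type*} [Fintype n] [DecidableEq n]

/-- **Uniqueness of the hermitian exponent in the polar decomposition**: if `e^L e^L = e^{L′} e^{L′}` for hermitian
`L`, `L′` then `L = L′` (through ★ `exp_injective_of_isHermitian`). [cite: Knapp2002, Prop. 1.2] [cite: GoodmanWallachGTM255, Thm. 11.5.9] -/
theorem eq_of_isHermitian_of_exp_mul_exp_eq {L L' : Matrix n n ℂ} (hL : L.IsHermitian) (hL' : L'.IsHermitian)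
    (h : exp L * exp L = exp L' * exp L') : L = L' := by
  rw [← Matrix.exp_add_of_commute L L (Commute.refl L), ← Matrix.exp_add_of_commute L' L' (Commute.refl L'),
    ← two_smul ℂ L, ← two_smul ℂ L'] at h
  have h2 := Literature.Algebra.Lie.SelfAdjointHullPolar.exp_injective_of_isHermitian (hL.add hL) (hL'.add hL')
    (by rwa [← two_smul ℂ L, ← two_smul ℂ L'])
  rw [← two_smul ℂ L, ← two_smul ℂ L'] at h2
  exact smul_right_injective _ (two_ne_zero' ℂ) h2

/-- **The global Cartan decomposition of `U(J)`** for a hermitian involution `J`: every `g ∈ U(J)` is `k · exp L` with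
`k ∈ U(J) ∩ U(n)` and `L ∈ 𝔲(J)` hermitian (`RealMatrixGroup.HasCartanDecomposition (unitaryFormGroup J hJ hJJ)`).
Polar decomposition of `GL_n(ℂ)` (★ `exists_unitary_mul_exp_of_isUnit`) plus uniqueness of the hermitian exponent.
[cite: Knapp2002, Thm. 6.31 (c); Prop. 7.14] -/
theorem unitaryFormGroup_hasCartanDecomposition (J : Matrix n n ℂ) (hJ : Jᴴ = J) (hJJ : J * J = 1) :
    (unitaryFormGroup J hJ hJJ).HasCartanDecomposition := by
  intro g hg
  rw [mem_unitaryFormGroup_carrier_iff] at hg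
  obtain ⟨k, L, hk, hL, hM⟩ := exists_unitary_mul_exp_of_isUnit (Units.isUnit g)
  -- notation and basic facts
  set M : Matrix n n ℂ := (g : Matrix n n ℂ) with hMdef
  have hJu : IsUnit J := ⟨⟨J, J, hJJ, hJJ⟩, rfl⟩
  have hJinv : J⁻¹ = J := Matrix.inv_eq_left_inv hJJ
  have hkk : k * star k = 1 := mul_eq_one_comm.1 hk
  have hk' : kᴴ * k = 1 := by rw [← Matrix.star_eq_conjTranspose]; exact hk
  have hkk' : k * kᴴ = 1 := by rw [← Matrix.star_eq_conjTranspose]; exact hkk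
  have hEherm : (exp L).IsHermitian := hL.exp
  have hEH : (exp L)ᴴ = exp L := hEherm
  have hEinv : exp (-L) * exp L = 1 := by
    rw [← Matrix.exp_add_of_commute (-L) L ((Commute.refl L).neg_left), neg_add_cancel, exp_zero]
  have hEinv' : exp L * exp (-L) = 1 := by
    rw [← Matrix.exp_add_of_commute L (-L) ((Commute.refl L).neg_right), add_neg_cancel, exp_zero]
  -- `e^L (kᴴ J k) e^L = J` from `gᴴ J g = J`
  have hdag : Mᴴ = exp L * kᴴ := by rw [hM, Matrix.conjTranspose_mul, hEH]
  have hW : exp L * (kᴴ * J * k) * exp L = J := by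
    have h := hg
    rw [hdag, hM] at h
    calc exp L * (kᴴ * J * k) * exp L = exp L * kᴴ * J * (k * exp L) := by simp only [Matrix.mul_assoc]
      _ = J := h
  -- hence `kᴴ J k = e^{-L} J e^{-L}`
  have hWeq : kᴴ * J * k = exp (-L) * J * exp (-L) := by
    calc kᴴ * J * k = exp (-L) * (exp L * (kᴴ * J * k) * exp L) * exp (-L) := by
          calc kᴴ * J * k = (exp (-L) * exp L) * (kᴴ * J * k) * (exp L * exp (-L)) := by
                rw [hEinv, hEinv', Matrix.one_mul, Matrix.mul_one]
            _ = exp (-L) * (exp L * (kᴴ * J * k) * exp L) * exp (-L) := by simp only [Matrix.mul_assoc]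
      _ = exp (-L) * J * exp (-L) := by rw [hW]
  -- `(kᴴ J k)² = 1`
  have hWsq : (kᴴ * J * k) * (kᴴ * J * k) = 1 := by
    calc (kᴴ * J * k) * (kᴴ * J * k) = kᴴ * J * (k * kᴴ) * J * k := by simp only [Matrix.mul_assoc]
      _ = 1 := by rw [hkk', Matrix.mul_one, Matrix.mul_assoc kᴴ J J, hJJ, Matrix.mul_one, hk']
  -- the second hermitian exponent `L₂ = -(J L J)` with `exp L₂ = J e^{-L} J`
  have hL₂ : (-(J * L * J)).IsHermitian := by
    have h : (J * L * J).IsHermitian := by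
      change (J * L * J)ᴴ = J * L * J
      rw [Matrix.conjTranspose_mul, Matrix.conjTranspose_mul, hJ, hL.eq, Matrix.mul_assoc]
    exact h.neg
  have hexpL₂ : exp (-(J * L * J)) = J * exp (-L) * J := by
    have h := Matrix.exp_conj J (-L) hJu
    rw [hJinv] at h
    rw [← h, Matrix.mul_neg, Matrix.neg_mul]
  -- `(J e^{-L} J)² = e^L e^L`: from `(e^{-L} J e^{-L})² = 1`
  have hsq : exp (-(J * L * J)) * exp (-(J * L * J)) = exp L * exp L := by
    rw [hexpL₂]
    have h1 : exp (-L) * J * exp (-L) * (exp (-L) * J * exp (-L)) = 1 := by rw [← hWeq]; exact hWsq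
    -- multiply `h1` on the left and on the right by `e^L`, then conjugate by `J`
    have h2 : J * (exp (-L) * exp (-L)) * J = exp L * exp L := by
      have h3 : exp L * (exp (-L) * J * exp (-L) * (exp (-L) * J * exp (-L))) * exp L = exp L * exp L := by
        rw [h1, Matrix.mul_one]
      calc J * (exp (-L) * exp (-L)) * J
          = (exp L * exp (-L)) * J * (exp (-L) * exp (-L)) * J * (exp (-L) * exp L) := by
            rw [hEinv, hEinv', Matrix.one_mul, Matrix.mul_one]
        _ = exp L * (exp (-L) * J * exp (-L) * (exp (-L) * J * exp (-L))) * exp L := by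
            simp only [Matrix.mul_assoc]
        _ = exp L * exp L := h3
    calc J * exp (-L) * J * (J * exp (-L) * J) = J * (exp (-L) * (J * J) * exp (-L)) * J := by
          simp only [Matrix.mul_assoc]
      _ = J * (exp (-L) * exp (-L)) * J := by rw [hJJ, Matrix.mul_one]
      _ = exp L * exp L := h2
  -- uniqueness of the hermitian exponent: `-(J L J) = L`, i.e. `L ∈ 𝔲(J)`
  have hJLJ : -(J * L * J) = L := eq_of_isHermitian_of_exp_mul_exp_eq hL₂ hL hsq
  have hLJ : L * J + J * L = 0 := by
    have h : J * (-(J * L * J)) = J * L := by rw [hJLJ]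
    rw [Matrix.mul_neg, ← Matrix.mul_assoc, ← Matrix.mul_assoc, hJJ, Matrix.one_mul] at h
    -- `h : -(L * J) = J * L`
    rw [← h, add_neg_cancel]
  have hLlie : L ∈ (unitaryFormGroup J hJ hJJ).lie := by
    rw [mem_unitaryFormGroup_lie_iff, hL.eq]
    exact hLJ
  -- `e^{-L} ∈ U(J)`: `J e^{-L} = e^{L} J`, so `kᴴ J k = e^{-L} J e^{-L} = J`
  have hJexp : J * exp (-L) * J = exp L := by rw [← hexpL₂, hJLJ]
  have hkJk : kᴴ * J * k = J := by
    rw [hWeq]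
    calc exp (-L) * J * exp (-L) = exp (-L) * (J * exp (-L) * J) * J := by
          simp only [Matrix.mul_assoc, hJJ, Matrix.mul_one]
      _ = J := by rw [hJexp, hEinv, Matrix.one_mul]
  -- assemble: `k` is a unit in `U(J) ∩ U(n)` and `g = k · expGL L`
  have hkU : IsUnit k := by
    have h : k = M * exp (-L) := by
      rw [hM, Matrix.mul_assoc, hEinv', Matrix.mul_one]
    rw [h]
    exact (Units.isUnit g).mul (Matrix.isUnit_exp _)
  refine ⟨hkU.unit, ?_, L, hLlie, hL, ?_⟩
  · rw [RealMatrixGroup.mem_maximalCompact_iff, mem_unitaryFormGroup_carrier_iff, IsUnit.unit_spec]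
    exact ⟨hkJk, hk⟩
  · ext : 1
    rw [Units.val_mul, IsUnit.unit_spec, coe_expGL]
    exact hM

/-- **The global Cartan decomposition of `U(α, β)`** at every signature:
`U(α, β) = (U(α) × U(β)) · exp 𝔭` (`RealMatrixGroup.HasCartanDecomposition (uFormGroup α β)`), the hypothesis `hG` of the
Harish-Chandra facts of `GKModules` and of `RealMatrixGroup.isMaximalCompact_maximalCompact` for the groups of the
hodgecm floor. [cite: Knapp2002, Thm. 6.31 (c); Prop. 7.14] -/
theorem uFormGroup_hasCartanDecomposition (α β : Type*) [Fintype α] [DecidableEq α] [Fintype β] [DecidableEq β] :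
    (uFormGroup α β).HasCartanDecomposition :=
  unitaryFormGroup_hasCartanDecomposition _ (conjTranspose_signForm α β) (signForm_mul_signForm α β)

/-! ## Edition 2: `U(J) ∩ U(n)` is a maximal compact subgroup of `U(J)` -/

/-- **`U(J) ∩ U(n)` is a MAXIMAL compact subgroup of `U(J)`** (`J` a hermitian involution): every compact subgroup `K′` of
`GL_n(ℂ)` with `U(J) ∩ U(n) ≤ K′ ≤ U(J)` equals `U(J) ∩ U(n)` — ★ `RealMatrixGroup.eq_maximalCompact_of_le_of_isCompact` with its
Cartan-decomposition hypothesis discharged by `unitaryFormGroup_hasCartanDecomposition` (and `A = ℂ` star-formally real,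
★ `isStarFormallyReal_complex`). [cite: Knapp2002, Thm. 6.31 (g); Prop. 7.19 (a)] -/
theorem unitaryFormGroup_eq_maximalCompact_of_le_of_isCompact (J : Matrix n n ℂ) (hJ : Jᴴ = J) (hJJ : J * J = 1)
    {K' : Subgroup (GL n ℂ)} (hK'G : K' ≤ (unitaryFormGroup J hJ hJJ).carrier)
    (hKK' : (unitaryFormGroup J hJ hJJ).maximalCompact ≤ K') (hK' : IsCompact (K' : Set (GL n ℂ))) :
    K' = (unitaryFormGroup J hJ hJJ).maximalCompact :=
  (unitaryFormGroup J hJ hJJ).eq_maximalCompact_of_le_of_isCompact isStarFormallyReal_complex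
    (unitaryFormGroup_hasCartanDecomposition J hJ hJJ) hK'G hKK' hK'

/-- **`U(α) × U(β)` is a MAXIMAL compact subgroup of `U(α, β)`** at every signature: a compact subgroup `K′` of `GL(α ⊕ β, ℂ)`
with `U(α) × U(β) ≤ K′ ≤ U(α, β)` equals `U(α) × U(β)` (`(uFormGroup α β).maximalCompact`).
[cite: Knapp2002, Thm. 6.31 (g); Prop. 7.19 (a)] -/
theorem uFormGroup_eq_maximalCompact_of_le_of_isCompact (α β : Type*) [Fintype α] [DecidableEq α] [Fintype β]
    [DecidableEq β] {K' : Subgroup (GL (α ⊕ β) ℂ)} (hK'G : K' ≤ (uFormGroup α β).carrier)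
    (hKK' : (uFormGroup α β).maximalCompact ≤ K') (hK' : IsCompact (K' : Set (GL (α ⊕ β) ℂ))) :
    K' = (uFormGroup α β).maximalCompact :=
  (uFormGroup α β).eq_maximalCompact_of_le_of_isCompact isStarFormallyReal_complex
    (uFormGroup_hasCartanDecomposition α β) hK'G hKK' hK'

end Literature.RepresentationTheory.KonnoKonno2007


end
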